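import Mathlib
import HarnessLib

/-!
# `RationalShortRootRigidity` — Step 1 helper: a real polynomial vanishing on a non-empty open set is zero

Helper lemma INSIDE the paper proof of crux `stmt-QuantumFields-23124` (`F4SubCurvatureDoor.RationalShortRootRigidity`,
LINE g15-A of planner ym-idea-3; Step 1 = `stub_reduce`, owner's plan HOME l15/STUB-PLAN-Reduce.md step 6(ii): the «small extra»
density lemma — `{q : R(q) ≠ 0}` is dense because a polynomial vanishing on a ball vanishes identically):

**Lemma** (`eq_zero_of_eval_eq_zero_on_open`).  If `F ∈ ℝ[x₁,…,xₙ]` vanishes at every point of a non-empty open set `U ⊆ ℝⁿ`, then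
`F = 0`.  Consequently (`dense_setOf_eval_ne_zero`) the non-vanishing set of a non-zero real polynomial is dense.

Proof: an open set contains a sup-metric ball, which is a product of open intervals (`ball_pi`), each infinite; `MvPolynomial.funext_set`.

Mathlib only; THEOREMS ONLY (no definitions); no named facts; no `sorry`; default heartbeats.  Nothing about the crux 23124, the
route's rung or the Yang–Mills mass gap is proved here.  Free-hands seat `ym-line-frs-p2` g10, `--supports stmt-QuantumFields-23124`.
-/

set_option autoImplicit false

namespace Summit.QuantumFields.YangMills.Theorems.RationalShortRootRigidity

/-- A real polynomial vanishing on a non-empty open subset of `ℝⁿ` is the zero polynomial. [folklore] -/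
theorem eq_zero_of_eval_eq_zero_on_open {n : ℕ} (F : MvPolynomial (Fin n) ℝ) (U : Set (Fin n → ℝ))
    (hU : IsOpen U) (hne : U.Nonempty) (h : ∀ x ∈ U, MvPolynomial.eval x F = 0) : F = 0 := by
  obtain ⟨x, hx⟩ := hne
  obtain ⟨ε, hε, hball⟩ := Metric.isOpen_iff.1 hU x hx
  rw [ball_pi x hε] at hball
  refine MvPolynomial.funext_set (fun i => Metric.ball (x i) ε) (fun i => ?_) fun y hy => ?_
  · rw [Real.ball_eq_Ioo]
    exact Set.Ioo_infinite (by linarith)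
  · rw [map_zero]
    exact h y (hball hy)

/-- The non-vanishing set of a non-zero real polynomial is dense in `ℝⁿ`. [folklore] -/
theorem dense_setOf_eval_ne_zero {n : ℕ} (F : MvPolynomial (Fin n) ℝ) (hF : F ≠ 0) :
    Dense {x : Fin n → ℝ | MvPolynomial.eval x F ≠ 0} := by
  rw [dense_iff_inter_open]
  intro U hU hne
  by_contra hcon
  rw [Set.not_nonempty_iff_eq_empty] at hcon
  apply hF
  refine eq_zero_of_eval_eq_zero_on_open F U hU hne fun x hx => ?_
  by_contra hx'
  have : x ∈ U ∩ {x : Fin n → ℝ | MvPolynomial.eval x F ≠ 0} := ⟨hx, hx'⟩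
  rw [hcon] at this
  exact this

end Summit.QuantumFields.YangMills.Theorems.RationalShortRootRigidity
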